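import Mathlib
import Literature.AlgebraicGeometry.Resolution.CobordantGame
import Literature.AlgebraicGeometry.Resolution.CobordantChartCoefficients
import Literature.AlgebraicGeometry.Resolution.CobordantChartPlaneSlice
import Literature.AlgebraicGeometry.Resolution.CobordantTupleGame
import Summits.ResolutionOfSingularities.ResolutionOfSingularities.Theorems.WeightedInvariantLocalWeightedDropWildTerminalCalculus

/-!
# `WeightedInvariant.LocalWeightedDrop`, line `hasse-ridge-face-selection`: coefficient calculus for the TERMINAL purely
# inseparable surface forms, part 2 — the axis chart in coefficients, and the apex of the binomial cone `y^d + λ x₁^a x₂^b`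

Crux item stmt-ResolutionOfSingularities-8899 `LocalWeightedDrop` (route `ResolutionOfSingularities/WeightedInvariant`),
serving the door `WeightedConstruction` stmt-ResolutionOfSingularities-0571.  [OURS · L1 W4.3, chain w43, stub worker 1
(gen 2): helpers for the candidate piece S3πT `stub_wildPurelyInseparableTerminalWon` of the S3 cut (terminal cases of
Hauser–Perlega, PRIMS 60 (2024) §3, in the local weighted resolution game).  Not a statement of any manuscript.]

Contents (all elementary):
* the axis chart of the curve blow-up `V(x_i, y)` followed by the slice `y_i = 0`, coefficient by coefficient
  (`coeff_slice_subst_axisChart_zero/one`: a bijection on exponents weighted by powers of `c_i`), whence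
  `order_slice_subst_axisChart_lt` (the order does not go up past a bound) and the constant coefficients
  `constantCoeff_slice_subst_axisChart`, `constantCoeff_slice_subst_pointChart`;
* the degree-`d` form of `y^d + x₁^a x₂^b U` (`a + b = d`) as a function, `initEval_X_pow_add_rename_monomialUnit`
  (`v ↦ v_y^d + U(0) v₁^a v₂^b`), and `exists_initEval_add_ne_of_monomialUnit`: for `a, b ≥ 1` every non-zero translation
  moves it (the binomial cone has trivial apex), the input of `TangentConeCut.apexFreeStartsWon`.
-/

set_option linter.dupNamespace false -- mandated namespace of this single-conjunct summit

namespace Summit.ResolutionOfSingularities.ResolutionOfSingularities.Theorems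

open Literature.AlgebraicGeometry.Resolution

namespace WildTerminal

open MvPowerSeries Literature.AlgebraicGeometry.Resolution.CobordantGame

variable {k : Type} [Field k]

/-! ### The axis chart followed by the slice, in coefficients -/

/-- The weight `e_i` of an exponent is its `i`-th entry. -/
theorem weight_axis (i : Fin 2) (d : Fin 2 →₀ ℕ) :
    Finsupp.weight (fun l : Fin 2 => if l = i then 1 else 0) d = d i := by
  classical
  have h : (fun l : Fin 2 => if l = i then (1 : ℕ) else 0) = Pi.single i 1 := by
    funext l
    by_cases hl : l = i
    · subst hl; simp
    · simp [hl]
  rw [h, Finsupp.weight_single_one_apply]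

/-- `(2 : Fin 3).succAbove` transports `(r, j)` to `(r, j, 0) = cons r (single 0 j)`. -/
theorem mapDomain_succAbove_two (β : Fin 2 →₀ ℕ) :
    Finsupp.mapDomain (Fin.succ (1 : Fin 2)).succAbove β = Finsupp.cons (β 0) (Finsupp.single 0 (β 1)) := by
  have hβ : β = Finsupp.single 0 (β 0) + Finsupp.single 1 (β 1) := by
    ext i; fin_cases i <;> simp
  conv_lhs => rw [hβ]
  rw [Finsupp.mapDomain_add, Finsupp.mapDomain_single, Finsupp.mapDomain_single]
  have h20 : Fin.succAbove (Fin.succ (1 : Fin 2)) (0 : Fin 2) = 0 := by decide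
  have h21 : Fin.succAbove (Fin.succ (1 : Fin 2)) (1 : Fin 2) = 1 := by decide
  rw [h20, h21]
  ext j
  refine Fin.cases ?_ (fun l => ?_) j
  · simp
  · rw [Finsupp.cons_succ]
    fin_cases l <;> simp

/-- THE AXIS-CHART TRANSFORM FOLLOWED BY THE SLICE, IN COEFFICIENTS (the generic term of the sum). -/
theorem finsum_axisChart_eq (i j : Fin 2) (hij : j ≠ i) (ci : k) (g : MvPowerSeries (Fin 2) k) (b : ℕ)
    (β' : Fin 2 →₀ ℕ) (hβ'i : β' i = 0) :
    (∑ᶠ d : Fin 2 →₀ ℕ, if Finsupp.weight (fun l : Fin 2 => if l = i then 1 else 0) d = b then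
        coeff d g * ∏ l, (((d l).choose (β' l) : k) * (fun l : Fin 2 => if l = i then ci else 0) l ^ (d l - β' l))
      else 0) =
      ci ^ b * coeff (Finsupp.single i b + Finsupp.single j (β' j)) g := by
  classical
  have hji : i ≠ j := fun h => hij h.symm
  rw [finsum_eq_single _ (Finsupp.single i b + Finsupp.single j (β' j))]
  · rw [weight_axis, if_pos (by simp [hij]), Fin.prod_univ_two]
    -- evaluate the two factors
    have hval : ∀ l : Fin 2, (((Finsupp.single i b + Finsupp.single j (β' j) : Fin 2 →₀ ℕ) l).choose (β' l) : k) *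
        (fun l : Fin 2 => if l = i then ci else 0) l ^
          ((Finsupp.single i b + Finsupp.single j (β' j) : Fin 2 →₀ ℕ) l - β' l) =
        if l = i then ci ^ b else 1 := by
      intro l
      by_cases hl : l = i
      · subst hl
        simp [hji, hβ'i]
      · have hlj : l = j := by
          fin_cases i <;> fin_cases j <;> fin_cases l <;> simp_all
        subst hlj
        simp [hij]
    rw [hval 0, hval 1]
    fin_cases i
    · simp [mul_comm]
    · simp [mul_comm]
  · intro d hd
    by_cases hw : Finsupp.weight (fun l : Fin 2 => if l = i then 1 else 0) d = b
    · rw [if_pos hw]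
      rw [weight_axis] at hw
      -- `d j ≠ β' j`, so the `j`-factor vanishes
      have hdj : d j ≠ β' j := by
        intro h
        apply hd
        ext l
        by_cases hl : l = i
        · subst hl; simp [hji, hw]
        · have hlj : l = j := by
            fin_cases i <;> fin_cases j <;> fin_cases l <;> simp_all
          subst hlj; simp [hij, h]
      have hzero : (((d j).choose (β' j) : k) * (fun l : Fin 2 => if l = i then ci else 0) j ^ (d j - β' j)) = 0 := by
        dsimp only
        rw [if_neg hij]
        rcases lt_or_gt_of_ne hdj with hlt | hgt
        · rw [Nat.choose_eq_zero_of_lt hlt, Nat.cast_zero, zero_mul]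
        · rw [zero_pow (Nat.sub_ne_zero_of_lt hgt), mul_zero]
      rw [Finset.prod_eq_zero (Finset.mem_univ j) hzero, mul_zero]
    · rw [if_neg hw]

/-- THE SLICE OF THE AXIS-CHART TRANSFORM, COEFFICIENT BY COEFFICIENT (`i = 0`):
`[x₁'^r x₂'^t] (g ∘ chart₀)|_{y₁=0} = c₁^r · [x₁^r x₂^t] g`. -/
theorem coeff_slice_subst_axisChart_zero (ci : k) (g : MvPowerSeries (Fin 2) k) (β : Fin 2 →₀ ℕ) :
    coeff β (TupleGame.slice (0 : Fin 2) (subst (CobordantChart.chart (fun l : Fin 2 => if l = 0 then 1 else 0)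
        (fun l : Fin 2 => if l = 0 then ci else 0)) g)) =
      ci ^ (β 0) * coeff (Finsupp.single 0 (β 0) + Finsupp.single 1 (β 1)) g := by
  unfold TupleGame.slice
  rw [CobordantChartPlaneSlice.coeff_subst_slice, show Fin.succ (0 : Fin 2) = Fin.succ (0 : Fin 2) from rfl,
    CobordantChartPlaneSlice.mapDomain_succAbove_one, CobordantChart.coeff_subst_chart _ _ (fun l hl => by
      by_cases h : l = 0
      · simp [h] at hl
      · simp [h])]
  have h := finsum_axisChart_eq (0 : Fin 2) 1 (by decide) ci g (β 0) (Finsupp.single 1 (β 1)) (by simp)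
  rw [h, Finsupp.single_eq_same]

/-- THE SLICE OF THE AXIS-CHART TRANSFORM, COEFFICIENT BY COEFFICIENT (`i = 1`; the variables get swapped):
`[x₁'^r x₂'^t] (g ∘ chart₁)|_{y₂=0} = c₂^r · [x₁^t x₂^r] g`. -/
theorem coeff_slice_subst_axisChart_one (ci : k) (g : MvPowerSeries (Fin 2) k) (β : Fin 2 →₀ ℕ) :
    coeff β (TupleGame.slice (1 : Fin 2) (subst (CobordantChart.chart (fun l : Fin 2 => if l = 1 then 1 else 0)
        (fun l : Fin 2 => if l = 1 then ci else 0)) g)) =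
      ci ^ (β 0) * coeff (Finsupp.single 1 (β 0) + Finsupp.single 0 (β 1)) g := by
  unfold TupleGame.slice
  rw [CobordantChartPlaneSlice.coeff_subst_slice, mapDomain_succAbove_two, CobordantChart.coeff_subst_chart _ _ (fun l hl => by
      by_cases h : l = 1
      · simp [h] at hl
      · simp [h])]
  have h := finsum_axisChart_eq (1 : Fin 2) 0 (by decide) ci g (β 0) (Finsupp.single 0 (β 1)) (by simp)
  rw [h, Finsupp.single_eq_same]

/-- THE SLICE OF THE AXIS-CHART TRANSFORM DOES NOT RAISE THE ORDER BEYOND THE OLD ONE: if `ord g < n` then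
`ord ((g ∘ chart_i)|) < n` (`c_i ≠ 0`). -/
theorem order_slice_subst_axisChart_lt (i : Fin 2) {ci : k} (hci : ci ≠ 0) (g : MvPowerSeries (Fin 2) k) {n : ℕ}
    (hg : g.order < n) :
    (TupleGame.slice i (subst (CobordantChart.chart (fun l : Fin 2 => if l = i then 1 else 0)
        (fun l : Fin 2 => if l = i then ci else 0)) g)).order < n := by
  classical
  have hgne : g ≠ 0 := ne_zero_of_order_lt hg
  have hfin : g.order ≠ ⊤ := by rwa [Ne, order_eq_top_iff]
  obtain ⟨o, ho⟩ := ENat.ne_top_iff_exists.mp hfin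
  obtain ⟨⟨β₀, hβ₀, hβ₀d⟩, -⟩ := order_eq_nat.mp ho.symm
  -- the exponent of the slice carrying `coeff β₀ g`
  have key : ∃ β : Fin 2 →₀ ℕ, β.degree = β₀.degree ∧
      coeff β (TupleGame.slice i (subst (CobordantChart.chart (fun l : Fin 2 => if l = i then 1 else 0)
        (fun l : Fin 2 => if l = i then ci else 0)) g)) ≠ 0 := by
    have hi : i = 0 ∨ i = 1 := by fin_cases i <;> simp
    rcases hi with rfl | rfl
    · refine ⟨Finsupp.single 0 (β₀ 0) + Finsupp.single 1 (β₀ 1), ?_, ?_⟩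
      · simp [Finsupp.degree_eq_sum, Fin.sum_univ_two]
      · have hβ : Finsupp.single 0 ((Finsupp.single 0 (β₀ 0) + Finsupp.single 1 (β₀ 1) : Fin 2 →₀ ℕ) 0) +
            Finsupp.single 1 ((Finsupp.single 0 (β₀ 0) + Finsupp.single 1 (β₀ 1) : Fin 2 →₀ ℕ) 1) = β₀ := by
          ext l; fin_cases l <;> simp
        rw [coeff_slice_subst_axisChart_zero, hβ]
        exact mul_ne_zero (pow_ne_zero _ hci) hβ₀
    · refine ⟨Finsupp.single 0 (β₀ 1) + Finsupp.single 1 (β₀ 0), ?_, ?_⟩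
      · simp [Finsupp.degree_eq_sum, Fin.sum_univ_two, add_comm]
      · have hβ : Finsupp.single 1 ((Finsupp.single 0 (β₀ 1) + Finsupp.single 1 (β₀ 0) : Fin 2 →₀ ℕ) 0) +
            Finsupp.single 0 ((Finsupp.single 0 (β₀ 1) + Finsupp.single 1 (β₀ 0) : Fin 2 →₀ ℕ) 1) = β₀ := by
          ext l; fin_cases l <;> simp [add_comm]
        rw [coeff_slice_subst_axisChart_one, hβ]
        exact mul_ne_zero (pow_ne_zero _ hci) hβ₀
  obtain ⟨β, hβdeg, hβ⟩ := key
  refine lt_of_le_of_lt (order_le hβ) ?_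
  rw [hβdeg, hβ₀d, ho]
  exact hg

/-- The slice of the axis-chart transform preserves the constant coefficient. -/
theorem constantCoeff_slice_subst_axisChart (i : Fin 2) (ci : k) (g : MvPowerSeries (Fin 2) k) :
    constantCoeff (TupleGame.slice i (subst (CobordantChart.chart (fun l : Fin 2 => if l = i then 1 else 0)
        (fun l : Fin 2 => if l = i then ci else 0)) g)) = constantCoeff g := by
  rw [constantCoeff_slice, constantCoeff_subst_of_constantCoeff_zero (constantCoeff_chart _ _ (fun l hl => by
      by_cases h : l = i
      · simp [h] at hl
      · simp [h]))]

/-- The slice of the point-chart transform preserves the constant coefficient. -/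
theorem constantCoeff_slice_subst_pointChart (i₀ : Fin 2) (c : Fin 2 → k) (U : MvPowerSeries (Fin 2) k) :
    constantCoeff (TupleGame.slice i₀ (subst (CobordantChart.chart (fun _ : Fin 2 => 1) c) U)) = constantCoeff U := by
  rw [constantCoeff_slice, constantCoeff_subst_of_constantCoeff_zero (constantCoeff_chart _ _
    (fun l hl => absurd hl one_ne_zero))]

/-! ### The apex of the binomial cone `y^d + λ x₁^a x₂^b` -/

/-- Coefficients of `x₁^a x₂^b · U` in total degree `≤ a + b`: only `x₁^a x₂^b` itself, with coefficient `U(0)`. -/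
theorem coeff_monomialUnit_of_degree_le (a b : ℕ) (U : MvPowerSeries (Fin 2) k) (β : Fin 2 →₀ ℕ)
    (hβ : β.degree ≤ a + b) :
    coeff β ((X 0 : MvPowerSeries (Fin 2) k) ^ a * X 1 ^ b * U) =
      if β = Finsupp.single 0 a + Finsupp.single 1 b then constantCoeff U else 0 := by
  classical
  have hmon : (X 0 : MvPowerSeries (Fin 2) k) ^ a * X 1 ^ b = monomial (Finsupp.single 0 a + Finsupp.single 1 b) 1 := by
    rw [X_pow_eq, X_pow_eq, monomial_mul_monomial, one_mul]
  rw [hmon, coeff_monomial_mul]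
  by_cases hle : Finsupp.single 0 a + Finsupp.single 1 b ≤ β
  · have heq : β = Finsupp.single 0 a + Finsupp.single 1 b := by
      refine le_antisymm ?_ hle
      -- equal degrees and `≤` force equality
      have hdeg' : (Finsupp.single 0 a + Finsupp.single 1 b : Fin 2 →₀ ℕ).degree = a + b := by
        rw [map_add, Finsupp.degree_single, Finsupp.degree_single]
      intro l
      have h0 := hle 0
      have h1 := hle 1
      have hsum : β 0 + β 1 ≤ a + b := by
        have : β.degree = β 0 + β 1 := by simp [Finsupp.degree_eq_sum, Fin.sum_univ_two]
        omega
      simp at h0 h1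
      fin_cases l <;> simp <;> omega
    rw [if_pos hle, if_pos heq, heq, tsub_self, one_mul, coeff_zero_eq_constantCoeff_apply]
  · rw [if_neg hle, if_neg]
    rintro rfl
    exact hle le_rfl

/-- THE DEGREE-`d` FORM OF `y^d + x₁^a x₂^b U` (`a + b = d ≥ 1`) AS A FUNCTION: `v ↦ v_y^d + U(0) v₁^a v₂^b`. -/
theorem initEval_X_pow_add_rename_monomialUnit {a b d : ℕ} (hd : 0 < d) (hab : a + b = d)
    (U : MvPowerSeries (Fin 2) k) (v : Fin (2 + 1) → k) :
    CobordantChart.initEval (fun _ : Fin (2 + 1) => 1) v d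
        ((X (Fin.last 2) : MvPowerSeries (Fin (2 + 1)) k) ^ d +
          rename (Fin.succAboveEmb (Fin.last 2)) ((X 0 : MvPowerSeries (Fin 2) k) ^ a * X 1 ^ b * U)) =
      v (Fin.last 2) ^ d + constantCoeff U * (v 0 ^ a * v 1 ^ b) := by
  classical
  set G : MvPowerSeries (Fin 2) k := (X 0 : MvPowerSeries (Fin 2) k) ^ a * X 1 ^ b * U with hG
  set E₁ : Fin (2 + 1) →₀ ℕ := Finsupp.single (Fin.last 2) d with hE₁
  set E₂ : Fin (2 + 1) →₀ ℕ := Finsupp.embDomain (Fin.succAboveEmb (Fin.last 2))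
    (Finsupp.single 0 a + Finsupp.single 1 b) + Finsupp.single (Fin.last 2) 0 with hE₂
  have hcoeff : ∀ E : Fin (2 + 1) →₀ ℕ, E.degree = d →
      coeff E ((X (Fin.last 2) : MvPowerSeries (Fin (2 + 1)) k) ^ d + rename (Fin.succAboveEmb (Fin.last 2)) G) =
        (if E = E₁ then 1 else 0) + (if E = E₂ then constantCoeff U else 0) := by
    intro E hE
    obtain ⟨β, hEeq⟩ := TschirnhausForm.exists_eq_emb_add_single E
    have hdeg := TschirnhausForm.degree_emb_add_single β (E (Fin.last 2))
    rw [← hEeq, hE] at hdeg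
    rw [hEeq, coeff_X_pow_add_rename]
    congr 1
    · -- the `y^d` part
      by_cases h : d = E (Fin.last 2) ∧ β = 0
      · rw [if_pos h, if_pos]
        rw [h.2, Finsupp.embDomain_zero, zero_add, ← h.1]
      · rw [if_neg h, if_neg]
        intro hE1
        apply h
        have hl := DFunLike.congr_fun hE1 (Fin.last 2)
        rw [TschirnhausForm.emb_add_single_last, hE₁, Finsupp.single_eq_same] at hl
        refine ⟨hl.symm, ?_⟩
        have : β.degree = 0 := by omega
        exact (Finsupp.degree_eq_zero_iff β).mp this
    · -- the `x'`-part
      by_cases hn : E (Fin.last 2) = 0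
      · rw [if_pos hn, hG, coeff_monomialUnit_of_degree_le a b U β (by omega)]
        by_cases hβ : β = Finsupp.single 0 a + Finsupp.single 1 b
        · rw [if_pos hβ, if_pos]
          rw [hE₂, hβ, hn]
        · rw [if_neg hβ, if_neg]
          intro hE2
          apply hβ
          rw [hE₂, hn] at hE2
          have := add_right_cancel hE2
          exact Finsupp.embDomain_injective _ this
      · rw [if_neg hn, if_neg]
        intro hE2
        apply hn
        have hl := DFunLike.congr_fun hE2 (Fin.last 2)
        rw [TschirnhausForm.emb_add_single_last, hE₂, TschirnhausForm.emb_add_single_last] at hl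
        exact hl
  have hne : E₁ ≠ E₂ := by
    intro h
    have hl := DFunLike.congr_fun h (Fin.last 2)
    rw [hE₁, Finsupp.single_eq_same, hE₂, TschirnhausForm.emb_add_single_last] at hl
    omega
  rw [ApexFreeOrderDrop.initEval_one_eq_sum, Finset.sum_eq_add E₁ E₂ hne]
  · rw [hcoeff E₁ (by rw [hE₁, Finsupp.degree_single]), hcoeff E₂ (by
      rw [hE₂, TschirnhausForm.degree_emb_add_single, map_add, Finsupp.degree_single, Finsupp.degree_single]; omega),
      if_pos rfl, if_neg hne, if_neg (Ne.symm hne), if_pos rfl, add_zero, zero_add, one_mul]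
    congr 1
    · rw [Finset.prod_eq_single (Fin.last 2)]
      · rw [hE₁, Finsupp.single_eq_same]
      · intro i _ hi
        rw [hE₁, Finsupp.single_eq_of_ne hi, pow_zero]
      · intro h
        exact absurd (Finset.mem_univ _) h
    · congr 1
      rw [Fin.prod_univ_castSucc, hE₂, TschirnhausForm.emb_add_single_last, pow_zero, mul_one, Fin.prod_univ_two,
        TschirnhausForm.emb_add_single_castSucc, TschirnhausForm.emb_add_single_castSucc]
      simp
  · intro E hE hE12
    rw [hcoeff E ((ApexFreeOrderDrop.mem_antidiag_iff d E).mp hE ▸ (ApexFreeOrderDrop.weight_one_eq_degree E).symm),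
      if_neg hE12.1, if_neg hE12.2, add_zero, zero_mul]
  · intro h
    exact absurd ((ApexFreeOrderDrop.mem_antidiag_iff d E₁).mpr (by
      rw [ApexFreeOrderDrop.weight_one_eq_degree, hE₁, Finsupp.degree_single])) h
  · intro h
    exact absurd ((ApexFreeOrderDrop.mem_antidiag_iff d E₂).mpr (by
      rw [ApexFreeOrderDrop.weight_one_eq_degree, hE₂, TschirnhausForm.degree_emb_add_single, map_add,
        Finsupp.degree_single, Finsupp.degree_single]; omega)) h

/-- THE BINOMIAL CONE `y^d + λ x₁^a x₂^b` (`λ ≠ 0`, `a, b ≥ 1`, `a + b = d`) HAS TRIVIAL APEX: every non-zero translation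
moves the degree-`d` form of `y^d + x₁^a x₂^b U`. -/
theorem exists_initEval_add_ne_of_monomialUnit {a b d : ℕ} (hd : 0 < d) (ha : 0 < a) (hb : 0 < b) (hab : a + b = d)
    {U : MvPowerSeries (Fin 2) k} (hU : constantCoeff U ≠ 0) (c : Fin (2 + 1) → k) (hc : c ≠ 0) :
    ∃ v : Fin (2 + 1) → k,
      CobordantChart.initEval (fun _ : Fin (2 + 1) => 1) (v + c) d
          ((X (Fin.last 2) : MvPowerSeries (Fin (2 + 1)) k) ^ d +
            rename (Fin.succAboveEmb (Fin.last 2)) ((X 0 : MvPowerSeries (Fin 2) k) ^ a * X 1 ^ b * U)) ≠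
        CobordantChart.initEval (fun _ : Fin (2 + 1) => 1) v d
          ((X (Fin.last 2) : MvPowerSeries (Fin (2 + 1)) k) ^ d +
            rename (Fin.succAboveEmb (Fin.last 2)) ((X 0 : MvPowerSeries (Fin 2) k) ^ a * X 1 ^ b * U)) := by
  simp only [initEval_X_pow_add_rename_monomialUnit hd hab, Pi.add_apply, ne_eq]
  have h10 : (1 : Fin (2 + 1)) ≠ 0 := by decide
  have ha0 : a ≠ 0 := by omega
  have hb0 : b ≠ 0 := by omega
  have hd0 : d ≠ 0 := by omega
  by_cases hc0 : c 0 = 0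
  · by_cases hc1 : c 1 = 0
    · -- `c = (0, 0, c_y)` with `c_y ≠ 0`: translate the origin
      have hc2 : c 2 ≠ 0 := by
        intro h
        apply hc
        funext l
        have hl : l = 0 ∨ l = 1 ∨ l = 2 := by fin_cases l <;> simp
        rcases hl with rfl | rfl | rfl
        · exact hc0
        · exact hc1
        · exact h
      refine ⟨0, ?_⟩
      simp [hc0, hc1, zero_pow ha0, zero_pow hd0]
      exact fun h => absurd h hc2
    · -- `c₂ ≠ 0`: kill the `x₂`-coordinate of `v + c`
      by_cases hc2 : c 2 = 0
      · refine ⟨Function.update (Function.update 0 0 1) 1 (-c 1), ?_⟩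
        simp [Function.update_of_ne, h10.symm, hc0, hc2, zero_pow hb0, zero_pow hd0]
        exact ⟨hU, fun h => absurd h hc1⟩
      · refine ⟨Function.update 0 1 (-c 1), ?_⟩
        simp [Function.update_of_ne, h10.symm, hc0, zero_pow ha0, zero_pow hb0, zero_pow hd0]
        exact fun h => absurd h hc2
  · -- `c₁ ≠ 0`: kill the `x₁`-coordinate of `v + c`
    by_cases hc2 : c 2 = 0
    · refine ⟨Function.update (Function.update 0 1 1) 0 (-c 0), ?_⟩
      simp [Function.update_of_ne, h10, hc2, zero_pow ha0, zero_pow hd0]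
      exact ⟨hU, fun h => absurd h hc0⟩
    · refine ⟨Function.update 0 0 (-c 0), ?_⟩
      simp [Function.update_of_ne, h10, zero_pow ha0, zero_pow hb0, zero_pow hd0]
      exact fun h => absurd h hc2

end WildTerminal

end Summit.ResolutionOfSingularities.ResolutionOfSingularities.Theorems
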